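import Summits.QuantumFields.GaugeBoot.DiagonalRPTorusHexAnnulusValue
import Summits.QuantumFields.GaugeBoot.DiagonalRPTorusRestFarPairs
import HarnessLib

/-!
# The bent-hexagon witness observable (gauge-boot, L3 `d = 3` uniform window, J2 brick 8)

HONEST FRAMING (cell `pub-gaugeboot`, page 1 of every file): the venture produces certified bounds
on lattice expectations at stated coupling, gauge group, dimension and torus size; NOT a mass gap,
NOT a continuum limit, NOT a string tension; NOT Yang–Mills-summit-bearing (barriers
`FixedCouplingUltralocality`, `PerturbativeInvisibility`). This module is bookkeeping for a
structural NEGATIVE result (a coupling window UNIFORM in the torus size for the failure of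
inner-half diagonal reflection positivity on `(ℤ/L)^3`); it proves no window.

## Content (torus `(ℤ/L)^3`, any group; word layer `LatticeWords`)

Generic word facts: `wordHolonomy_gaugeTransform` (conjugation covariance), `isGaugeInvariant_reTr_wordHolonomy`
(closed words), `wordHolonomy_configDiagSwap` (the mirror `θ` acts on words by swapping the axes,
`Step.swap01`), `wordHolonomy_siteTranslate`, `dependsOn_reTr_wordHolonomy` (a word observable
reads only `edgesRead`).

The witness: `hexObs ρ y₀ U = Re χ(hol_{y₀}(hexW))` — the bent hexagon `γ_{y₀}`; with
`y₀ = θ(y + 2e₀)` and `a = y - y₀`: ★ `hexObs ∘ Θ = hexF ρ y`, ★ `hexObs ∘ τ_a = hexG ρ y`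
(the two observables of `DiagonalRPTorusHexAnnulusValue`); supports `dependsOn_hexF/hexG`
(`Et y LE₁`, `Et y LE₂`), `disjoint_Et` ; `dependsOn_hexObs` (`hexLinks y₀`), `tsd_hexLinks_le`
(links within torus distance `1` of `y₀`), and ★ `isInnerHalfObservable_hexObs_sub` — the witness
`hexObs y₀ - hexObs y` is an inner-half observable when `δ(y) = δ(y₀) = c - 1`.

Elementary; no named fact.
-/

open MeasureTheory Finset Function

namespace Summit.QuantumFields.GaugeBoot

open Literature.MathematicalPhysics.QuantumFieldTheory
open Literature.MathematicalPhysics.QuantumFieldTheory.PlaquetteLowerBound (reTr)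

noncomputable section

namespace DiagRPHex

open DiagRPTube DiagRPUnif

/-! ## Generic word facts -/

section Words

variable {d L : ℕ} {N : ℕ} {G : Type*} [Group G] (ρ : G →* Matrix (Fin N) (Fin N) ℂ)

/-- **Gauge covariance of word holonomies**: `hol_x(w)(U^γ) = γ(x) hol_x(w)(U) γ(end)⁻¹`. -/
theorem wordHolonomy_gaugeTransform (γ : Site d L → G) (U : GaugeConfig d L G) :
    ∀ (x : Site d L) (w : Word d), wordHolonomy (gaugeTransform γ U) x w =
      γ x * wordHolonomy U x w * (γ (Word.endpoint x w))⁻¹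
  | x, [] => by simp [Word.endpoint]
  | x, s :: w => by
    rw [wordHolonomy_cons, wordHolonomy_cons, Word.endpoint_cons, wordHolonomy_gaugeTransform γ U (s.apply x) w]
    cases s with
    | fwd μ => simp only [stepHolonomy, gaugeTransform, Step.apply]; group
    | bwd μ =>
      simp only [stepHolonomy, gaugeTransform, Step.apply]
      have : (x - Pi.single μ 1 : Site d L).shift μ = x := by simp [Site.shift]
      rw [this]; group

/-- A closed word observable `Re χ(hol_x(w))` is gauge invariant. -/
theorem isGaugeInvariant_reTr_wordHolonomy {x : Site d L} {w : Word d} (hclosed : Word.endpoint x w = x) :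
    IsGaugeInvariant fun U : GaugeConfig d L G => reTr ρ (wordHolonomy U x w) := by
  intro γ U
  show reTr ρ (wordHolonomy (gaugeTransform γ U) x w) = reTr ρ (wordHolonomy U x w)
  rw [wordHolonomy_gaugeTransform, hclosed, DiagRPSUN.reTr_mul_comm, ← mul_assoc, inv_mul_cancel, one_mul]

/-- The mirror `θ = (i j)` on steps. -/
def Step.swapAxes (i j : Fin d) : Step d → Step d
  | .fwd μ => .fwd (Equiv.swap i j μ)
  | .bwd μ => .bwd (Equiv.swap i j μ)

/-- `θ(x - e_μ) = θx - e_{θμ}`. -/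
theorem siteDiagSwap_sub_single (i j : Fin d) (x : Site d L) (μ : Fin d) :
    siteDiagSwap i j (x - Pi.single μ 1) = siteDiagSwap i j x - Pi.single (Equiv.swap i j μ) 1 := by
  funext k
  simp only [siteDiagSwap, Pi.sub_apply, Pi.single_apply, Equiv.swap_apply_eq_iff]

/-- **The mirror acts on words**: `hol_x(w)(ΘU) = hol_{θx}(θw)(U)`. -/
theorem wordHolonomy_configDiagSwap (i j : Fin d) (U : GaugeConfig d L G) :
    ∀ (x : Site d L) (w : Word d), wordHolonomy (configDiagSwap i j U) x w =
      wordHolonomy U (siteDiagSwap i j x) (w.map (Step.swapAxes i j))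
  | x, [] => by simp
  | x, s :: w => by
    rw [List.map_cons, wordHolonomy_cons, wordHolonomy_cons, wordHolonomy_configDiagSwap i j U (s.apply x) w]
    cases s with
    | fwd μ =>
      simp only [stepHolonomy, configDiagSwap, edgeDiagSwap, Step.swapAxes, Step.apply, siteDiagSwap_shift]
    | bwd μ =>
      simp only [stepHolonomy, configDiagSwap, edgeDiagSwap, Step.swapAxes, Step.apply,
        siteDiagSwap_sub_single]

/-- Translating the endpoint of a step. -/
theorem Step.apply_add (x a : Site d L) (s : Step d) : s.apply x + a = s.apply (x + a) := by
  cases s with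
  | fwd μ => simp only [Step.apply, Site.shift]; abel
  | bwd μ => simp only [Step.apply]; abel

/-- Translating the link of a step. -/
theorem Step.edge_add (x a : Site d L) (s : Step d) : ((s.edge x).1 + a, (s.edge x).2) = s.edge (x + a) := by
  cases s with
  | fwd μ => rfl
  | bwd μ => simp only [Step.edge, Prod.mk.injEq, and_true]; abel

/-- **Translations act on words**: `hol_x(w)(τ_a U) = hol_{x+a}(w)(U)`. -/
theorem wordHolonomy_siteTranslate (a : Site d L) (U : GaugeConfig d L G) :
    ∀ (x : Site d L) (w : Word d), wordHolonomy (U.siteTranslate a) x w = wordHolonomy U (x + a) w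
  | x, [] => by simp
  | x, s :: w => by
    rw [wordHolonomy_cons, wordHolonomy_cons, wordHolonomy_siteTranslate a U (s.apply x) w,
      stepHolonomy_eq, stepHolonomy_eq, GaugeConfig.siteTranslate_apply, Step.edge_add, Step.apply_add]

/-- Configurations agreeing on the links read by a word give the same holonomy. -/
theorem wordHolonomy_congr_of_edgesRead :
    ∀ (x : Site d L) (w : Word d) {U V : GaugeConfig d L G},
      (∀ e ∈ Word.edgesRead x w, U e = V e) → wordHolonomy U x w = wordHolonomy V x w
  | x, [], _, _, _ => by simp
  | x, s :: w, U, V, h => by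
    rw [wordHolonomy_cons, wordHolonomy_cons, stepHolonomy_eq, stepHolonomy_eq,
      h _ (by simp [Word.edgesRead_cons]),
      wordHolonomy_congr_of_edgesRead (s.apply x) w fun e he => h e (by simp [Word.edgesRead_cons, he])]

/-- **A word observable reads only the links it traverses.** -/
theorem dependsOn_reTr_wordHolonomy (x : Site d L) (w : Word d) :
    DependsOn (fun U : GaugeConfig d L G => reTr ρ (wordHolonomy U x w)) {e | e ∈ Word.edgesRead x w} :=
  fun _ _ h => by simp only [wordHolonomy_congr_of_edgesRead x w fun e he => h e he]

end Words

/-! ## The hexagon observable -/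

section Hexagon

variable {L : ℕ} {N : ℕ} {G : Type*} [Group G] (ρ : G →* Matrix (Fin N) (Fin N) ℂ)

/-- THE WITNESS OBSERVABLE: `Re χ` of the holonomy around the bent hexagon `γ_{y₀}`. -/
def hexObs (y₀ : Site 3 L) (U : GaugeConfig 3 L G) : ℝ := reTr ρ (wordHolonomy U y₀ hexW)

/-- The chart base is charted by the origin. -/
theorem site_zero (y : Site 3 L) : site y (0, 0, 0) = y := by
  funext k; fin_cases k <;> simp [site]

/-- `θ` of `hexW` is `thexW`. -/
theorem map_swapAxes_hexW : hexW.map (Step.swapAxes (0 : Fin 3) 1) = thexW := by decide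

/-- ★ **The mirrored witness is `hexF`**: with `y₀ = θ(y + 2e₀)`, `hexObs y₀ ∘ Θ = hexF ρ y`. -/
theorem hexObs_configDiagSwap (y : Site 3 L) (U : GaugeConfig 3 L G) :
    hexObs ρ (siteDiagSwap (0 : Fin 3) 1 (site y (2, 0, 0))) (configDiagSwap (0 : Fin 3) 1 U) = hexF ρ y U := by
  rw [hexObs, wordHolonomy_configDiagSwap, siteDiagSwap_siteDiagSwap, map_swapAxes_hexW]; rfl

/-- ★ **The translated witness is `hexG`**: with `a = y - y₀`, `hexObs y₀ ∘ τ_a = hexG ρ y`. -/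
theorem hexObs_siteTranslate (y y₀ : Site 3 L) (U : GaugeConfig 3 L G) :
    hexObs ρ y₀ (U.siteTranslate (y - y₀)) = hexG ρ y U := by
  rw [hexObs, wordHolonomy_siteTranslate, add_sub_cancel, hexG, site_zero]

/-- The hexagon observable reads `hexLinks y₀`. -/
theorem dependsOn_hexObs (y₀ : Site 3 L) :
    DependsOn (hexObs (G := G) ρ y₀) (hexLinks y₀ : Set (Edge 3 L)) := by
  have h := dependsOn_reTr_wordHolonomy (G := G) ρ (site y₀ (0, 0, 0)) hexW
  rw [site_zero] at h
  refine fun U V hUV => h fun e he => hUV e ?_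
  rw [Set.mem_setOf_eq, ← site_zero y₀, edgesRead_site, ledges_hexW.1] at he
  rw [mem_coe, ← Et_LE₂]
  exact List.mem_toFinset.2 he

/-- `hexF` reads `Et y LE₁`. -/
theorem dependsOn_hexF (y : Site 3 L) : DependsOn (hexF (G := G) ρ y) (Et y LE₁ : Set (Edge 3 L)) := by
  refine fun U V hUV => dependsOn_reTr_wordHolonomy (G := G) ρ (site y (2, 0, 0)) thexW fun e he => hUV e ?_
  rw [Set.mem_setOf_eq, edgesRead_site] at he
  rw [mem_coe, Et, List.mem_toFinset]
  obtain ⟨ℓ, hℓ, rfl⟩ := List.mem_map.1 he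
  exact List.mem_map.2 ⟨ℓ, ledges_thexW_perm.subset hℓ, rfl⟩

/-- `hexG` reads `Et y LE₂`. -/
theorem dependsOn_hexG (y : Site 3 L) : DependsOn (hexG (G := G) ρ y) (Et y LE₂ : Set (Edge 3 L)) := by
  refine fun U V hUV => dependsOn_reTr_wordHolonomy (G := G) ρ (site y (0, 0, 0)) hexW fun e he => hUV e ?_
  rw [Set.mem_setOf_eq, edgesRead_site, ledges_hexW.1] at he
  rw [mem_coe, Et, List.mem_toFinset]
  exact he

/-- `hexF`, `hexG`, `hexObs` are gauge invariant (closed words). -/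
theorem isGaugeInvariant_hexF (y : Site 3 L) : IsGaugeInvariant (hexF (G := G) ρ y) :=
  isGaugeInvariant_reTr_wordHolonomy ρ (by rw [endpoint_site, lendpoint_hexW.2])

/-- The two supports are disjoint (`L > 8`). -/
theorem disjoint_Et (hL : 8 < L) (y : Site 3 L) : Disjoint (Et y LE₁) (Et y LE₂) := by
  rw [Finset.disjoint_left]
  intro e h1 h2
  obtain ⟨ℓ₁, hℓ₁, rfl⟩ := mem_Et.1 h1
  obtain ⟨ℓ₂, hℓ₂, he⟩ := mem_Et.1 h2
  have := edge_injOn y (B := 4) (by omega) (inBox_LE₂ ℓ₂ hℓ₂) (inBox_LE₁ ℓ₁ hℓ₁) he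
  subst this
  have hdis : ∀ ℓ ∈ LE₂, ℓ ∉ LE₁ := by decide
  exact hdis ℓ₂ hℓ₂ hℓ₁

variable [NeZero L]

/-- Chart points with `0/1` coordinates are within torus distance `1` of the base. -/
theorem tsd_site_le_one (y : Site 3 L) {x : LSite} (h0 : x.1 = 0 ∨ x.1 = 1)
    (h1 : x.2.1 = 0 ∨ x.2.1 = 1) (h2 : x.2.2 = 0 ∨ x.2.2 = 1) : tsd y (site y x) ≤ 1 := by
  refine tsd_le_of_forall fun k => ?_
  have hc : ∀ z : ℤ, z = 0 ∨ z = 1 → cyc ((z : ZMod L)) ≤ 1 := by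
    rintro z (rfl | rfl)
    · simp [cyc]
    · simpa using cyc_one_le (L := L)
  fin_cases k <;> simp only [site, add_sub_cancel_left] <;> [exact hc _ h0; exact hc _ h1; exact hc _ h2]

/-- ★ The hexagon links lie within torus distance `1` of the base point. -/
theorem tsd_hexLinks_le (y₀ : Site 3 L) : ∀ e ∈ hexLinks y₀, tsd y₀ e.1 ≤ 1 := by
  intro e he
  rw [← Et_LE₂, mem_Et] at he
  obtain ⟨ℓ, hℓ, rfl⟩ := he
  simp only [LE₂, List.mem_cons, List.not_mem_nil, or_false] at hℓ
  rcases hℓ with rfl | rfl | rfl | rfl | rfl | rfl <;>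
    exact tsd_site_le_one y₀ (by decide) (by decide) (by decide)

omit [NeZero L] in
/-- Endpoints of the hexagon links lie on the layers `δ(y₀)` and `δ(y₀) - 1`. -/
theorem lay_hexLinks (y₀ : Site 3 L) : ∀ e ∈ hexLinks y₀,
    (lay (0 : Fin 3) 1 e.1 = lay 0 1 y₀ ∨ lay (0 : Fin 3) 1 e.1 = lay 0 1 y₀ - 1) ∧
      (lay (0 : Fin 3) 1 (e.1.shift e.2) = lay 0 1 y₀ ∨ lay (0 : Fin 3) 1 (e.1.shift e.2) = lay 0 1 y₀ - 1) := by
  intro e he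
  rw [← Et_LE₂, mem_Et] at he
  obtain ⟨ℓ, hℓ, rfl⟩ := he
  simp only [LE₂, List.mem_cons, List.not_mem_nil, or_false] at hℓ
  simp only [edge]
  rcases hℓ with rfl | rfl | rfl | rfl | rfl | rfl <;>
    simp only [← site_add_lvec, lay_site, loff, lvec] <;> norm_num [sub_eq_add_neg]

omit [NeZero L] in
/-- ★ **The witness difference is an inner-half observable** when both bases sit on the layer
`c - 1` (`L = 2c`, `c ≥ 2`). -/
theorem isInnerHalfObservable_hexObs_sub {c : ℕ} (hc : 2 ≤ c) (hLc : L = 2 * c) {y₀ y : Site 3 L}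
    (hy₀ : lay (0 : Fin 3) 1 y₀ = ((c - 1 : ℕ) : ZMod L)) (hy : lay (0 : Fin 3) 1 y = ((c - 1 : ℕ) : ZMod L)) :
    IsInnerHalfObservable (0 : Fin 3) 1 fun U : GaugeConfig 3 L G => hexObs ρ y₀ U - hexObs ρ y U := by
  intro U V hUV
  have hL2 : L / 2 = c := by omega
  have hval : ∀ {y' : Site 3 L}, lay (0 : Fin 3) 1 y' = ((c - 1 : ℕ) : ZMod L) →
      ∀ e ∈ hexLinks y', U e = V e := by
    intro y' hy' e he
    obtain ⟨h1, h2⟩ := lay_hexLinks y' e he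
    have hv : ∀ z : ZMod L, (z = lay 0 1 y' ∨ z = lay 0 1 y' - 1) → z.val < L / 2 := by
      rintro z (rfl | rfl)
      · rw [hy', hL2]; exact val_cast_lt hLc (by omega)
      · rw [hy', hL2, DiagRPRest.cast_pred_sub_one hc]; exact val_cast_lt hLc (by omega)
    exact hUV e (hv _ h1) (hv _ h2)
  show hexObs ρ y₀ U - hexObs ρ y U = hexObs ρ y₀ V - hexObs ρ y V
  rw [dependsOn_hexObs ρ y₀ (hval hy₀), dependsOn_hexObs ρ y (hval hy)]

end Hexagon

end DiagRPHex

end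

end Summit.QuantumFields.GaugeBoot
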